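import Mathlib
import Summits.Ventures.PercRepro2.Defs
import Summits.Ventures.PercRepro2.Independence
import Summits.Ventures.PercRepro2.Harris
import Summits.Ventures.PercRepro2.Graph
import Summits.Ventures.PercRepro2.Exploration
import Summits.Ventures.PercRepro2.Events
import Summits.Ventures.PercRepro2.Induced
import Summits.Ventures.PercRepro2.BHKEvents
import Summits.Ventures.PercRepro2.BHKAvoid
import Summits.Ventures.PercRepro2.ZCPendantSecondOrder
import Summits.Ventures.PercRepro2.CDRequired
import Summits.Ventures.PercRepro2.CCTRootEdge
import Summits.Ventures.PercRepro2.OneEdge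
import Summits.Ventures.PercRepro2.OneRootDropMono
import Summits.Ventures.PercRepro2.AvoidMono
import Summits.Ventures.PercRepro2.CDNested
import Summits.Ventures.PercRepro2.CDAvoidAnti
import Summits.Ventures.PercRepro2.CDNestedEdgeLemmas
import Summits.Ventures.PercRepro2.CDNestedEdgeChains

/-!
# Row 2′CD for the first nested pair of routes: the edge `{a₁, a₃}` against the path `a₁ – y – a₃`
(blind cell PercRepro2, mine-a g34; MINE-A.md §89.7, proofs/MINEA-CD-NESTED.md)

The nested-routes theorem in its smallest non-trivial instance.  Let `ε = {a₁, a₃}`, `b₁ = {a₁, y}`,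
`b₂ = {y, a₃}` be three distinct edges and suppose that under `Q = {a₁ ↮ a₂}` these are the only
routes from `a₁` to `a₃`:

  `Q ∩ {a₁ ↔ a₃} = Q ∩ ({ε open} ∪ {b₁ open} ∩ {b₂ open})`

(`K₄` with `y = o`, the diamond, the paw with `a₂` pendant at `y`, the 4-cycle with the chord `ε`, …).
Then row 2′CD holds for every up-set and every weight vector (`cd_of_edge_and_path`).

Proof = `CDNested.cd_of_two_worlds` with the worlds `p₁ = p[ε ↦ 1]` (weight `p_ε`) and
`p₂ = p[ε ↦ 0, b₁ ↦ 1, b₂ ↦ 1]` (weight `(1 − p_ε) p_{b₁} p_{b₂}`): the four `a₃`-required masses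
decompose over the two worlds (`prob_inter_two_worlds`), and the propensities are ordered —
pinning `b₁` and then `b₂` open raises `P(U ∣ Q)` (`AvoidMono.avoid_mono`, with the avoided set
growing `{a₁, a₃} → {a₁, a₃, y}`) and lowers `P(o ∈ C₂ ∣ Q)` (`CDAvoidAnti.avoid_anti`), and once
`b₁, b₂` are open the edge `ε` joins two vertices already connected, so its state is irrelevant
(`OneEdge.conn_update_true_iff`).  No definition; one seat.
-/

namespace Summit.Ventures.PercRepro2

namespace CDNestedEdge

section Main

variable {V : Type*} {E : Type*} [Fintype E] [DecidableEq E] [Fintype V] [DecidableEq V]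
  {R : Type*} [Field R] [LinearOrder R] [IsStrictOrderedRing R]

variable {ends : E → Sym2 V} {ε b₁ b₂ : E} {a₁ a₃ y : V}

/-- **Row 2′CD for the edge `{a₁, a₃}` against the path `a₁ – y – a₃`.** If, under `Q = {a₁ ↮ a₂}`,
the only `a₁–a₃` routes are the edge `ε = {a₁, a₃}` and the path `b₁ = {a₁, y}`, `b₂ = {y, a₃}`
(`Q ∩ {a₁ ↔ a₃} = Q ∩ ({ε open} ∪ {b₁ open} ∩ {b₂ open})`), then the row holds for every up-set `𝓔` and
every admissible weight vector (`K₄` with `y = o`, the diamond, the paw with `a₂` pendant at `y`, …). -/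
theorem cd_of_edge_and_path (p : E → R) (hp : IsProbVec p) (a₂ o : V) (hε : ends ε = s(a₁, a₃))
    (hb₁ : ends b₁ = s(a₁, y)) (hb₂ : ends b₂ = s(y, a₃)) (h1 : b₁ ≠ ε) (h2 : b₂ ≠ ε)
    (h12 : b₂ ≠ b₁) {𝓔 : Set (Set V)} (h𝓔 : IsUpperSet 𝓔)
    (hQe : (connEvent ends a₁ a₂)ᶜ ∩ connEvent ends a₁ a₃ =
      (connEvent ends a₁ a₂)ᶜ ∩ (openEdge ε ∪ (openEdge b₁ ∩ openEdge b₂))) :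
    let Q := (connEvent ends a₁ a₂)ᶜ
    let U := clusterInEvent ends a₁ 𝓔
    let e := connEvent ends a₁ a₃
    let f := connEvent ends a₂ o
    let N := (connEvent ends a₁ a₃)ᶜ ∩ (connEvent ends a₂ a₃)ᶜ
    let oU := connEvent ends a₁ o ∪ connEvent ends a₂ o
    prob p (Q ∩ N) * (prob p Q * prob p (Q ∩ U ∩ e ∩ f) - prob p (Q ∩ U) * prob p (Q ∩ e ∩ f)) ≤
      prob p (Q ∩ N ∩ oU) * (prob p Q * prob p (Q ∩ U ∩ e) - prob p (Q ∩ U) * prob p (Q ∩ e)) := by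
  intro Q U e f N oU
  set W := openEdge ε ∪ (openEdge b₁ ∩ openEdge b₂) with hW
  have hpt : ∀ ω, ω ∈ Q → (ω ∈ e ↔ ω ∈ W) := by
    intro ω hQ
    have h := Set.ext_iff.1 hQe ω
    simp only [Set.mem_inter_iff] at h
    exact ⟨fun he => (h.1 ⟨hQ, he⟩).2, fun hc => (h.2 ⟨hQ, hc⟩).2⟩
  have hp₁ : IsProbVec (Function.update p ε 1) := hp.update ε zero_le_one le_rfl
  have hp₂ : IsProbVec (Function.update (Function.update (Function.update p ε 0) b₁ 1) b₂ 1) :=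
    ((hp.update ε le_rfl zero_le_one).update b₁ zero_le_one le_rfl).update b₂ zero_le_one le_rfl
  have hν₂ : 0 ≤ (1 - p ε) * p b₁ * p b₂ :=
    mul_nonneg (mul_nonneg (sub_nonneg.2 (hp.le_one ε)) (hp.nonneg b₁)) (hp.nonneg b₂)
  have eA : Q ∩ U ∩ e ∩ f = (Q ∩ U ∩ f) ∩ W := by
    ext ω; have h := hpt ω; simp only [Set.mem_inter_iff]; tauto
  have eB : Q ∩ U ∩ e = (Q ∩ U) ∩ W := by
    ext ω; have h := hpt ω; simp only [Set.mem_inter_iff]; tauto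
  have eC : Q ∩ e ∩ f = (Q ∩ f) ∩ W := by
    ext ω; have h := hpt ω; simp only [Set.mem_inter_iff]; tauto
  have eD : Q ∩ e = Q ∩ W := hQe
  refine CDNested.cd_of_two_worlds p (Function.update p ε 1)
    (Function.update (Function.update (Function.update p ε 0) b₁ 1) b₂ 1) hp hp₁ hp₂ ends a₁ a₂ a₃ o
    h𝓔 (ν₁ := p ε) (ν₂ := (1 - p ε) * p b₁ * p b₂) (hp.nonneg ε) hν₂ ?_ ?_ ?_ ?_ ?_ ?_
  · show prob p (Q ∩ U ∩ e ∩ f) = _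
    rw [eA, prob_inter_two_worlds p _ h1 h2 h12]
  · show prob p (Q ∩ U ∩ e) = _
    rw [eB, prob_inter_two_worlds p _ h1 h2 h12]
  · show prob p (Q ∩ e ∩ f) = _
    rw [eC, prob_inter_two_worlds p _ h1 h2 h12]
  · show prob p (Q ∩ e) = _
    rw [eD, prob_inter_two_worlds p _ h1 h2 h12]
  · exact beta_mono p hp hε hb₁ hb₂ h1 h2 h12 a₂ h𝓔
  · exact gamma_anti p hp hε hb₁ hb₂ h1 h2 h12 a₂ o

end Main

end CDNestedEdge

end Summit.Ventures.PercRepro2
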